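import Literature.NumberTheory.LFunctions.ConreyIwaniec2002Prop64OfOne
import Literature.NumberTheory.LFunctions.ConreyIwaniec2002ShiftedConvolutionOf
import Literature.NumberTheory.LFunctions.ConreyIwaniec2002CircleMethodAssembly
import Literature.NumberTheory.LFunctions.ConreyIwaniec2002HeckeVoronoi
import HarnessLib

/-!
# Conrey–Iwaniec (2002), Proposition 6.4 modulo the open registered stubs of line `theta-circle-method`

B. Conrey, H. Iwaniec, Acta Arith. 103 (2002) 259–312, Proposition 6.4 [held text
`paper:arxiv-math_0111012`, p0014–p0017], Theorems 4.3/4.4 (p0012), Propositions 3.2/3.3 (p0009).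
With S3b3 (Theorem 4.1 / Corollary 4.2: `CircleMethod.circle_assembly`) and V2 (Hecke–Voronoi at
weight one: `hecke_voronoi`) now tree theorems, the typed `conreyIwaniec2002_proposition64` follows from
the REMAINING registered stubs of SKELETON S3 / SUB-SKELETON S3d (cell `landau-siegel/ls-inputs`):
S3c1 (`BesselJZeroAmplitude`), S3c2 ((4.5) for the Bessel kernels from the amplitude), V1 (the
`ω`-relation of the class-group theta series, Propositions 3.2/3.3 via (2.23)–(2.39)), S3e1 (genus
classification of the main-term coefficients) and S3e2 ((4.27)–(4.34)) — every hypothesis below is the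
registered text verbatim (as consumed by the tree's `shifted_convolution_of_stubs` and
`voronoi_theta_of_omega_hecke`). Seat ls-inputs-P64-lead g2 (integration). No claim about
Landau–Siegel zeros.

## References
* [ConreyIwaniec2002] B. Conrey, H. Iwaniec, Acta Arith. 103 (2002) 259–312: Proposition 6.4 (6.52),
  Theorems 4.1–4.4, Propositions 3.2–3.3.
-/

noncomputable section

open scoped NumberField FourierTransform
open Complex MeasureTheory

namespace Literature.NumberTheory.LFunctions

namespace ConreyIwaniec2002

open NumberField Literature.NumberTheory.LFunctions.NumberField
open Literature.Analysis.FunctionSpaces (besselJ)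

/-- **Proposition 6.4 from the open stubs S3c1, S3c2, V1, S3e1, S3e2** (S3b3 = Theorem 4.1 and
V2 = Hecke–Voronoi are discharged by the tree theorems `CircleMethod.circle_assembly`,
`hecke_voronoi`; S3a, S3b1, S3b2, S3f, V3 inside `shifted_convolution_of_stubs` /
`voronoi_theta_of_omega_hecke`). [cite: ConreyIwaniec2002, Proposition 6.4 (6.52)] -/
theorem proposition64_of_open_stubs
    (hc1 : ∃ C_W : ℝ, 0 < C_W ∧ BesselJZeroAmplitude C_W)
    (hc2 :
    ∀ C_W : ℝ, 0 < C_W → BesselJZeroAmplitude C_W →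
      ∃ B₀ : ℝ, 1 ≤ B₀ ∧ ∀ (q : ℕ), 1 ≤ q → ∀ r : ℕ → ℕ, (∀ c : ℕ, 1 ≤ r c ∧ r c ≤ q) →
        KernelFourierBound q (B₀ * (q : ℝ) ^ (3 / 2 : ℝ)) (ciBesselKernel r))
    (hV1 :
    ∀ (q : ℕ) [NeZero q], 4 < q → Odd q → ∀ χ : DirichletCharacter ℂ q,
      χ.IsPrimitive → χ.IsQuadratic → χ.Odd →
        ∀ (K : Type) [Field K] [NumberField K],
          Module.finrank ℚ K = 2 → NumberField.discr K = -(q : ℤ) →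
            ∀ (ψ : ClassGroup (𝓞 K) →* ℂˣ) (c : ℕ), 1 ≤ c →
              ∃ ψ' : ClassGroup (𝓞 K) →* ℂˣ, IsGenusCharFor (ψ' * ψ⁻¹) (Nat.gcd c q) ∧
                ∀ a abar : ℤ, a * abar ≡ 1 [ZMOD c] →
                  ∃ η : ℂ, ‖η‖ = 1 ∧
                    IsOmegaRelated ((c : ℝ) * Real.sqrt (q / Nat.gcd c q : ℕ)) η
                      (twistCount K (classGroupCharIdealHom ψ))
                      (twistCount K (classGroupCharIdealHom ψ'))
                      (thetaConst K ψ) (thetaConst K ψ')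
                      ((a : ℝ) / c)
                      (-((abar * ((((q / Nat.gcd c q : ℕ) : ZMod c)⁻¹).val : ℤ) : ℤ) : ℝ) / c))
    (he1 :
    ∀ (q : ℕ) [NeZero q], 4 < q → Odd q → ∀ χ : DirichletCharacter ℂ q,
      χ.IsPrimitive → χ.IsQuadratic → χ.Odd →
        ∀ (K : Type) [Field K] [NumberField K],
          Module.finrank ℚ K = 2 → NumberField.discr K = -(q : ℤ) →
            ∀ (ψ : ClassGroup (𝓞 K) →* ℂˣ),
              (∀ c : ℕ, voronoiMainCoeff q ‖χ.LFunction 1‖ ψ c = 0) ∨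
                ∃ v w : ℕ, v * w = q ∧
                  ∀ c : ℕ, voronoiMainCoeff q ‖χ.LFunction 1‖ ψ c =
                    genusSigmaCoeff q ‖χ.LFunction 1‖ v w c)
    (he2 :
    ∀ (q : ℕ), Squarefree q → ∀ (v w : ℕ), v * w = q → ∀ (ℓ : ℝ), 0 ≤ ℓ →
      IsCISigma q ℓ (ciSigma (genusSigmaCoeff q ℓ v w))) :
    conreyIwaniec2002_proposition64 :=
  proposition64_of_shiftedConvolution
    (shifted_convolution_of_stubs CircleMethod.circle_assembly hc1 hc2
      (voronoi_theta_of_omega_hecke hV1 hecke_voronoi) he1 he2)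

end ConreyIwaniec2002

end Literature.NumberTheory.LFunctions

end
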